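import Summits.QuantumFields.BalabanUV.T4Continuum.Support.NE7GaugeSliceMapFacts
import HarnessLib

/-!
# NE7LevelQGaugeInvariance — INFINITESIMAL DATA INVARIANCE OF TRIVIAL-CORNER GAUGES (ROAD-G114 §9 (S3a)): at a unitary periodic small-field `U♯` the differential `levelQ′` of the
# `(j+1)`-fold-average coordinate kills every linearised trivial-corner gauge direction `skewPR(∇̃_{U♯} ζ)` — the `t`-derivative at `0` of the EXACT invariance
# `NE7GaugeSliceMapFacts.levelQ_sliceMap` along `t ↦ (U♯)^{exp(tζ)}` (chain rule with `hasStrictFDerivAt_levelQ` and `NE7GaugeActionChart.hasDerivAt_gaugeChart_gauge`)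

Cell `pub-balaban`, rung (B)+1 sub-cell t4, lineage `b2b-balaban-t4-ne7-p1` (CRUX PROVER NE7 #1 = OWNER of BINDER row NE7), generation 114.  Memo `t4/b2b-balaban-t4-ne7-p1-g114/ROAD-G114.md` §9.
WHAT ([folklore]; 0 def, 0 sorry; `d = 4`).  **`levelQ'_gaugeDir_eq_zero`** (used by (S3b) `NE7SliceStraightening` for the surjectivity of `levelQ′` on the gauge slice).
HONEST FRAMING (page 1): soft calculus over landed letters; radii existential; nothing of Bałaban's; NOT NE7, NOT NE3; spine 0∕9; finite T⁴ rung (B)+1 — NOT infinite volume, NOT mass gap, NOT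
BetaPertH, NOT Clay.
-/

set_option autoImplicit false

open scoped BigOperators Matrix Matrix.Norms.L2Operator Topology
open NormedSpace Finset Set Filter Metric

namespace Summit.QuantumFields.BalabanUV.T4Continuum.NE7LevelQGaugeInvariance

open Literature.MathematicalPhysics.QuantumFieldTheory.Balaban1983to89
open B7Prop1Explicit B7Prop2Explicit MatrixLog
open T4AveragingDeficitWall (IsUnitaryCfg SmallField)
open T4AveragingDeficitWallBoundary (IsPeriodicCfg)
open AveragingDeficitTorusChart (TDir chart chart_zero redN isUnitaryCfg_chart isPeriodicCfg_chart)
open AveragingDeficitChartCalculus (relLog)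
open AveragingDeficitTwoLevelPrep (skewSub mem_skewSub skewPR)
open AveragingDeficitMultiLevelPrep (tower levelQ levelQ' levelQ_self LevelSmall tower_ne_zero)
open AveragingDeficitMultiLevelFermat (hasStrictFDerivAt_levelQ levelQ'_onto)
open AveragingDeficitMultiLevelBridge (tower_eq)
open AveragingDeficitFermat (eventually_smallField_chart)
open MinimalActionSandwich (admissible)
open MinimalActionRate (sfClass)
open NE7AdmissibleFibreLHC (chart_id_eq_chart_skewP)
open NE7GaugeActionChart (gaugeChart_val hasDerivAt_gaugeChart_gauge)
open NE7GaugeSliceMapFacts (levelQ_sliceMap sliceMap_zero_gauge)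

noncomputable section

variable {n : Type} [Fintype n] [DecidableEq n]

set_option maxHeartbeats 1600000 in
/-- **INFINITESIMAL DATA INVARIANCE**: for a trivial-corner skew box field `ζ` the linearised gauge direction `skewPR(∇̃_{U♯}ζ)` lies in the kernel of the differential `levelQ′` of the
`(j+1)`-fold-average coordinate at `U♯` (differentiate the exact invariance `levelQ_sliceMap` along `t ↦ exp(tζ)`). [folklore] -/
theorem levelQ'_gaugeDir_eq_zero [Nonempty n] {L N : ℕ} [NeZero L] [NeZero N] (hL : 1 ≤ L) {ε : ℝ} (hε : 0 ≤ ε) (j : ℕ)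
    (hs : LevelSmall 4 L j (ε / ((L : ℝ) ^ (j + 1)) ^ 2)) {Us : Site 4 → Fin 4 → (Matrix n n ℂ)ˣ} (hUsu : IsUnitaryCfg Us)
    (hUsP : IsPeriodicCfg Us ((L * tower L N j : ℕ) : ℤ)) {a : ℝ} (haε : a < ε / ((L : ℝ) ^ (j + 1)) ^ 2) (hUsa : SmallField Us a)
    {ζ : (Fin 4 → Fin (L * tower L N j)) → Matrix n n ℂ} (hζ : ∀ r, ζ r ∈ skewAdjoint (Matrix n n ℂ))
    (hcorner : ∀ w : Site 4, ζ (redN (L * tower L N j) (((L : ℤ) ^ (j + 1)) • w)) = 0) :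
    levelQ' L N j Us (((skewPR (L * tower L N j) (fun r κ =>
      (((Us (boxVec (L * tower L N j) r) κ)⁻¹ : (Matrix n n ℂ)ˣ) : Matrix n n ℂ) * ζ r * (Us (boxVec (L * tower L N j) r) κ : Matrix n n ℂ)
        - ζ (redN (L * tower L N j) (boxVec (L * tower L N j) r + e κ))) : ↥(skewSub 4 n (L * tower L N j))) : TDir 4 n (L * tower L N j))) = 0 := by
  haveI : NeZero (L * tower L N j) := ⟨Nat.mul_ne_zero (NeZero.ne L) (tower_ne_zero L N j)⟩
  letI : NormedAlgebra ℚ (Matrix n n ℂ) := NormedAlgebra.restrictScalars ℚ ℂ (Matrix n n ℂ)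
  have hx : 0 ≤ ε / ((L : ℝ) ^ (j + 1)) ^ 2 := by positivity
  have eP : ((L * tower L N j : ℕ) : ℤ) = (L : ℤ) * (tower L N j : ℕ) := by push_cast; ring
  have hUsPN : IsPeriodicCfg Us ((N * L ^ (j + 1) : ℕ) : ℤ) := by rw [NE7AdmissibleFibreLHC.period_succ_eq]; exact hUsP
  have hUsP' : IsPeriodicCfg Us ((L : ℤ) * (tower L N j : ℕ)) := by rw [← eP]; exact hUsP
  have hUsx : SmallField Us (ε / ((L : ℝ) ^ (j + 1)) ^ 2) := MinimalActionRate.SmallField.mono hUsa haε.le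
  -- the curve `t ↦ A(tζ, 0)` and its derivative
  set Γ : ℝ → TDir 4 n (L * tower L N j) := fun t => relLog (L * tower L N j) Us (gaugeAct (fun x : Site 4 => expUnit ((t • ζ) (redN (L * tower L N j) x))) (chart (ContinuousLinearMap.id ℝ (Matrix n n ℂ)) (L * tower L N j) Us 0)) with hΓ
  set Dζ : TDir 4 n (L * tower L N j) := fun r κ => (((Us (boxVec (L * tower L N j) r) κ)⁻¹ : (Matrix n n ℂ)ˣ) : Matrix n n ℂ) * ζ r * (Us (boxVec (L * tower L N j) r) κ : Matrix n n ℂ) - ζ (redN (L * tower L N j) (boxVec (L * tower L N j) r + e κ)) with hDζ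
  have hΓd : HasDerivAt Γ Dζ 0 := by
    rw [hasDerivAt_pi]; intro r; rw [hasDerivAt_pi]; intro κ
    exact hasDerivAt_gaugeChart_gauge (L * tower L N j) Us ζ r κ
  -- the composite with `Q̄` is constant (`= 0`) near `t = 0`
  have hQ := hasStrictFDerivAt_levelQ (d := 4) (n := n) (M' := N) hL j hUsu hUsP' hx hs hUsx
  set Q : TDir 4 n (L * tower L N j) → ↥(skewSub 4 n N) := fun Φ => levelQ L N j Us (chart (ContinuousLinearMap.id ℝ (Matrix n n ℂ)) (L * tower L N j) Us Φ) with hQdef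
  have hQd : HasFDerivAt Q (levelQ' L N j Us) 0 := hQ.hasFDerivAt
  -- nearness and class membership along the curve, for small `t`
  have hcont : ∀ (r : Fin 4 → Fin (L * tower L N j)) (κ : Fin 4), Continuous fun t : ℝ =>
      (((Us (boxVec (L * tower L N j) r) κ)⁻¹ : (Matrix n n ℂ)ˣ) : Matrix n n ℂ) * (exp ((t • ζ) r) * ((Us (boxVec (L * tower L N j) r) κ : Matrix n n ℂ) * exp ((0 : TDir 4 n (L * tower L N j)) r κ)) * exp (-((t • ζ) (redN (L * tower L N j) (boxVec (L * tower L N j) r + e κ))))) := by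
    intro r κ
    have h1 : Continuous fun t : ℝ => exp ((t • ζ) r) := by
      simp only [Pi.smul_apply]; exact NormedSpace.exp_continuous.comp (continuous_id.smul continuous_const)
    have h2 : Continuous fun t : ℝ => exp (-((t • ζ) (redN (L * tower L N j) (boxVec (L * tower L N j) r + e κ)))) := by
      simp only [Pi.smul_apply]; exact NormedSpace.exp_continuous.comp (continuous_id.smul continuous_const).neg
    exact continuous_const.mul ((h1.mul continuous_const).mul h2)
  have hnear : ∀ᶠ t : ℝ in 𝓝 0, ∀ (r : Fin 4 → Fin (L * tower L N j)) (κ : Fin 4), ‖(((Us (boxVec (L * tower L N j) r) κ)⁻¹ : (Matrix n n ℂ)ˣ) : Matrix n n ℂ)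
      * ((gaugeAct (fun x : Site 4 => expUnit ((t • ζ) (redN (L * tower L N j) x))) (chart (ContinuousLinearMap.id ℝ (Matrix n n ℂ)) (L * tower L N j) Us (0 : TDir 4 n (L * tower L N j))) (boxVec (L * tower L N j) r) κ : (Matrix n n ℂ)ˣ) : Matrix n n ℂ)
        - 1‖ ≤ 1 / 4 := by
    refine Filter.eventually_all.mpr fun r => Filter.eventually_all.mpr fun κ => ?_
    have h0 : ‖(((Us (boxVec (L * tower L N j) r) κ)⁻¹ : (Matrix n n ℂ)ˣ) : Matrix n n ℂ) * (exp (((0 : ℝ) • ζ) r) * ((Us (boxVec (L * tower L N j) r) κ : Matrix n n ℂ) * exp ((0 : TDir 4 n (L * tower L N j)) r κ))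
        * exp (-(((0 : ℝ) • ζ) (redN (L * tower L N j) (boxVec (L * tower L N j) r + e κ))))) - 1‖ < 1 / 4 := by
      simp only [zero_smul, Pi.zero_apply, exp_zero, neg_zero, one_mul, mul_one, Units.inv_mul, sub_self, norm_zero]; norm_num
    have hev := ((((hcont r κ).sub continuous_const).norm).continuousAt (x := (0 : ℝ))).eventually (gt_mem_nhds h0)
    filter_upwards [hev] with t ht
    rw [gaugeChart_val]
    exact ht.le
  have hconst : ∀ᶠ t : ℝ in 𝓝 0, Q (((skewPR (L * tower L N j) (Γ t) : ↥(skewSub 4 n (L * tower L N j)))) : TDir 4 n (L * tower L N j)) = 0 := by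
    filter_upwards [hnear] with t ht
    have hcl : chart (ContinuousLinearMap.id ℝ (Matrix n n ℂ)) (L * tower L N j) Us ((0 : ↥(skewSub 4 n (L * tower L N j))) : TDir 4 n (L * tower L N j)) ∈ sfClass 4 L N ε (j + 1) := by
      rw [Submodule.coe_zero, chart_zero]
      exact ⟨hUsu, hUsPN, hUsx⟩
    have h := levelQ_sliceMap (n := n) hL hε j hs hUsu hUsP (ζ := t • ζ) (fun r' => by simpa only [Pi.smul_apply] using skewAdjoint.smul_mem t (hζ r'))
      (fun w => by rw [Pi.smul_apply, hcorner w, smul_zero]) (0 : ↥(skewSub 4 n (L * tower L N j))) hcl (by simpa only [Submodule.coe_zero] using ht)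
    simp only [Submodule.coe_zero] at h
    rw [hQdef]
    simp only
    rw [h, chart_zero, levelQ_self]
  -- differentiate: `levelQ′ (skewPR Dζ) = 0`
  have hΓ0 : Γ 0 = 0 := by
    have hz : ((0 : ℝ) • ζ) = 0 := zero_smul _ _
    simp only [hΓ, hz]
    exact NE7GaugeActionChart.gaugeChart_zero (L * tower L N j) Us
  have hcurve : HasDerivAt (fun t : ℝ => (((skewPR (L * tower L N j) (Γ t) : ↥(skewSub 4 n (L * tower L N j)))) : TDir 4 n (L * tower L N j))) ((((skewPR (L * tower L N j) Dζ : ↥(skewSub 4 n (L * tower L N j)))) : TDir 4 n (L * tower L N j))) 0 := by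
    have h1 : HasDerivAt (fun t : ℝ => skewPR (L * tower L N j) (Γ t)) (skewPR (L * tower L N j) Dζ) 0 := (skewPR (d := 4) (n := n) (L * tower L N j)).hasFDerivAt.comp_hasDerivAt 0 hΓd
    exact ((skewSub 4 n (L * tower L N j)).subtypeL).hasFDerivAt.comp_hasDerivAt 0 h1
  have hval0 : (((skewPR (L * tower L N j) (Γ 0) : ↥(skewSub 4 n (L * tower L N j)))) : TDir 4 n (L * tower L N j)) = 0 := by rw [hΓ0, map_zero]; rfl
  have hQd' : HasFDerivAt Q (levelQ' L N j Us) ((((skewPR (L * tower L N j) (Γ 0) : ↥(skewSub 4 n (L * tower L N j)))) : TDir 4 n (L * tower L N j))) := by rw [hval0]; exact hQd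
  have hcomp := hQd'.comp_hasDerivAt (0 : ℝ) hcurve
  have hzero : HasDerivAt (fun t : ℝ => Q (((skewPR (L * tower L N j) (Γ t) : ↥(skewSub 4 n (L * tower L N j)))) : TDir 4 n (L * tower L N j))) 0 0 :=
    (hasDerivAt_const (0 : ℝ) (0 : ↥(skewSub 4 n N))).congr_of_eventuallyEq hconst
  exact hcomp.unique hzero

end

end Summit.QuantumFields.BalabanUV.T4Continuum.NE7LevelQGaugeInvariance
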